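import Summits.BirchSwinnertonDyer.BirchSwinnertonDyer.Theorems.SylvesterTwoHeegnerIndexCoupledTelescopeLiftPackage
import Summits.BirchSwinnertonDyer.BirchSwinnertonDyer.Theorems.SylvesterTwoHeegnerIndexCoupledTelescopeLiftSupply
import Literature.NumberTheory.EllipticCurves.SelmerTorsionRestriction
import Literature.NumberTheory.EllipticCurves.SelmerTorsionCMOperatorJZero
import Literature.NumberTheory.EllipticCurves.SelmerProofs
import Literature.NumberTheory.EllipticCurves.BSDRankZeroDensity
import HarnessLib

/-!
# The COUPLED Cassels–Tate telescope, XIV: the LIFT FAMILY IN TREE CURRENCY — #K11 ∘ #K10 on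
# `H¹(ℚ, E[n]) → H¹(K, E_K[n])`, `Sel_n`, `torsionH1ToH1`, `resTorsion`, `kummerMapTorsion`
# (instantiation lane, planner D620/D625 (R1)(R4))

Crux `UpperOffV0HSYPlus` (stmt-BirchSwinnertonDyer-19804), display hT^κ = `…TailFourKappa` (p704180)
l.89–236, lift conjuncts l.205–236.  #K10 `exists_lift_family` (p705415) and #K11
`hlift_of_rational_lift` (p705565) are GENERIC-WITNESS: abstract groups `SQ, S, M₀, M, Q, QQ` and
binders `hsurjQ, htors, res, hresSel, hcomp, ι, hι, τ, hτw, hτx, hτwx, hprim, he`.  This file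
DISCHARGES every one of those binders that is a TREE FACT, for ANY Weierstrass curve `E/ℚ` over a number
field `K` at the Selmer level `n = 2^κ·2^κ` (for hT^κ: `E = cubeSumCurve ·`, `K = ℚ(ω)`):

* `SQ := galH1Torsion E n`, `S := galH1Torsion (E⁄K) n`, `M₀ := Ш(E/ℚ)[2^∞]`, `M := Ш(E_K/K)[2^∞]`
  (`AddCommGroup.primaryComponent _ 2`), `Q := (E⁄K).galH1`, `τ := torsionH1ToH1`, `ι := ↑↑`;
* `hsurjQ` ← `WeierstrassCurve.map_torsionH1ToH1_selmerGroup_holds` (AEC X.4.2(a): `Sel_n ↠ Ш[n]`)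
  + `2^κ` kills `Ш(E/ℚ)[2^∞]` (`hkℚ`); `htors` ← `zsmul_galH1Torsion_eq_zero` (`2^{2κ} = n`);
  `res := resTorsion E K ((2 ^ κ * 2 ^ κ : ℕ) : ℤ)`, `hresSel := resTorsion_mem_selmerGroup`, `hcomp` ←
  `torsionH1ToH1_resTorsion` + `hr` + `coe_shaRestriction_apply`; `hι` ← subtype injectivity;
  `hτw` ← the one-φ clauses (i) + `hw` (file XIII `…CoupledTelescopeOnePhi`); `hτx` ←
  `torsionH1ToH1_kummerMapTorsion`; `hτwx` ← (i) + `map_zero`; `hprim`, `he` ← `2`-primarity /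
  `hkℚ`; `hdesc` ← the descent bijection.

What stays DISPLAYED (rows', D620 (c)(d), D625 (R4)): the one-φ data `(φ, fn, hfn, r, w)` with its
consumed clauses (outputs of `exists_onePhi_package_of_omega` at this `n`), the `ℚ`-Lagrangian `L`
(output of #K8′ on the constructed pairing), `Adm` with `0 ∈ Adm` and `res (Sel_n(E/ℚ)) ⊆ Adm`, the
`ℚ`-KUMMER RESIDUE `(y, hy, hτy, hfree, hker)` at `T := 2κ` (B: `y = δ_n P`, A: `y = 0`), and the
bottom point `x₀` (class `x := kummerMapTorsion (E⁄K) n _ x₀`, the term of (iii) l.131–133).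
* `exists_lift_family_tree` — ⊢ #K10's NINE clauses in this currency (Selmer, admissible, zero
  beyond `m`, annihilation, exact orders, room `N i ≤ κ`, images in `D = closure (r(L) ∪ w '' r(L))`,
  `𝒪`-independence WITH `x` over any finset, (gen)) — the per-curve inputs of #K10b
  `interleaved_lift_clauses`.

Theorem-only (no definition, no named fact); nothing asserted on 19804; no stub closed; X12.CMAtTwo
NOT proved; BSD not claimed for any curve.  Sources: McCallum 1991 §5 Thm. 5.4 (proof, p. 288);
Silverman AEC X.4.2(a), VIII.§2; MEMO-bsd-cm-two §59.2, §64.5.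
-/

-- every Summits module is named `Summit.<Summit>.<Problem>…`: the duplicated component is by design
set_option linter.dupNamespace false
set_option autoImplicit false

noncomputable section

open scoped Classical

open WeierstrassCurve Literature.NumberTheory.EllipticCurves
  Literature.NumberTheory.GaloisRepresentations NumberField

namespace Summit.BirchSwinnertonDyer.BirchSwinnertonDyer.Theorems.SylvesterTwoCoupledTelescope

section LiftFamilyTree

variable (E : WeierstrassCurve ℚ) (K : Type) [Field K] [NumberField K]

/-- **The lift family of ONE curve, in tree currency** (module docstring): #K11's `hlift` supplied
from the tree's `Sel_n(E/ℚ) ↠ Ш(E/ℚ)[n]`, `n`-torsion of `H¹(ℚ, E[n])`, `resTorsion` and its two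
compatibilities, then #K10's family on `H¹(K, E_K[n])` with `τ := torsionH1ToH1`,
`w_S := resH1Hom id fn hfn`, bottom class `x := kummerMapTorsion _ n _ x₀`.  McCallum p. 288: «let
`d_i` be a generator of `D_i` and let `c_i` be a lifting of `d_i` to `S_{p^M}(E_K)`».
[cite: McCallumLMS1991, §5 Thm. 5.4 (proof, p. 288)] [cite: SilvermanAEC2009, Thm X.4.2(a)] -/
theorem exists_lift_family_tree (κ : ℕ)
    -- the one-φ data consumed (outputs of `exists_onePhi_package_of_omega` at `n := 2^κ·2^κ`)
    (φ : Isogeny (E.baseChange K)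
      (E.baseChange K))
    (fn : geomTorsion (E.baseChange K) ((2 ^ κ * 2 ^ κ : ℕ) : ℤ) →+
      geomTorsion (E.baseChange K) ((2 ^ κ * 2 ^ κ : ℕ) : ℤ))
    (hfn : ∀ (g : Field.absoluteGaloisGroup K)
      (P : geomTorsion (E.baseChange K) ((2 ^ κ * 2 ^ κ : ℕ) : ℤ)),
      fn (ContinuousMonoidHom.id _ g • P) = g • fn P)
    (r : AddCommGroup.primaryComponent E.sha 2 →+
      AddCommGroup.primaryComponent (E.baseChange K).sha 2)
    (w : AddCommGroup.primaryComponent (E.baseChange K).sha 2 →+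
      AddCommGroup.primaryComponent (E.baseChange K).sha 2)
    (hr : ∀ c, ((r c : AddCommGroup.primaryComponent
        (E.baseChange K).sha 2) :
      (E.baseChange K).sha) =
        shaRestriction E K c)
    (hw : ∀ x, (((w x : AddCommGroup.primaryComponent
        (E.baseChange K).sha 2) :
        (E.baseChange K).sha) :
          (E.baseChange K).galH1) =
      galH1Map φ.toAddMonoidHom φ.equivariant
        ((x : (E.baseChange K).sha) :
          (E.baseChange K).galH1))
    (hwS : ∀ c, torsionH1ToH1 (E.baseChange K)
        ((2 ^ κ * 2 ^ κ : ℕ) : ℤ) (resH1Hom (ContinuousMonoidHom.id _) fn hfn c) =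
      galH1Map φ.toAddMonoidHom φ.equivariant
        (torsionH1ToH1 (E.baseChange K) ((2 ^ κ * 2 ^ κ : ℕ) : ℤ) c))
    (hbij : Function.Bijective fun cd : AddCommGroup.primaryComponent
        E.sha 2 ×
      AddCommGroup.primaryComponent E.sha 2 ↦ r cd.1 + w (r cd.2))
    -- the `ℚ`-Lagrangian and the level: `2^κ` kills `Ш(E/ℚ)[2^∞]`
    (L : AddSubgroup (AddCommGroup.primaryComponent E.sha 2))
    [Finite L]
    (hkℚ : ∀ x ∈ AddCommGroup.primaryComponent E.sha 2,
      2 ^ κ • x = 0)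
    -- the admissible set (rows' ONE set per curve)
    (Adm : Set (galH1Torsion (E.baseChange K) ((2 ^ κ * 2 ^ κ : ℕ) : ℤ)))
    (h0 : (0 : galH1Torsion (E.baseChange K)
      ((2 ^ κ * 2 ^ κ : ℕ) : ℤ)) ∈ Adm)
    (hresAdm : ∀ u ∈ selmerGroup E ((2 ^ κ * 2 ^ κ : ℕ) : ℤ),
      resTorsion E K ((2 ^ κ * 2 ^ κ : ℕ) : ℤ) u ∈ Adm)
    -- the `ℚ`-Kummer residue at `T := 2κ`
    (y : galH1Torsion E ((2 ^ κ * 2 ^ κ : ℕ) : ℤ))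
    (hy : y ∈ selmerGroup E ((2 ^ κ * 2 ^ κ : ℕ) : ℤ))
    (hτy : torsionH1ToH1 E ((2 ^ κ * 2 ^ κ : ℕ) : ℤ) y = 0)
    (hfree : ∀ a : ℤ, a • y = 0 → ((2 : ℤ) ^ (2 * κ) ∣ a) ∨ y = 0)
    (hker : ∀ u ∈ selmerGroup E ((2 ^ κ * 2 ^ κ : ℕ) : ℤ),
      torsionH1ToH1 E ((2 ^ κ * 2 ^ κ : ℕ) : ℤ) u = 0 →
        ∃ a : ℤ, u = a • y)
    -- the bottom point
    (x₀ : ((E.baseChange K)).toAffine.Point) :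
    ∃ (m : ℕ) (s : ℕ → galH1Torsion (E.baseChange K)
        ((2 ^ κ * 2 ^ κ : ℕ) : ℤ)) (N : ℕ → ℕ),
      (∀ i, s i ∈ selmerGroup (E.baseChange K)
        ((2 ^ κ * 2 ^ κ : ℕ) : ℤ)) ∧
      (∀ i, s i ∈ Adm) ∧ (∀ i, m ≤ i → s i = 0 ∧ N i = 0) ∧
      (∀ i, ((2 : ℤ) ^ N i) • s i = 0) ∧
      (∀ i < m, N i ≠ 0 → ((2 : ℤ) ^ (N i - 1)) • s i ≠ 0) ∧
      (∀ i, N i ≤ κ) ∧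
      (∀ i, ∃ a ∈ AddSubgroup.closure ((r '' (L : Set _)) ∪ w '' (r '' (L : Set _))),
        torsionH1ToH1 (E.baseChange K) ((2 ^ κ * 2 ^ κ : ℕ) : ℤ)
            (s i) =
          ((a : (E.baseChange K).sha) :
            (E.baseChange K).galH1) ∧
        torsionH1ToH1 (E.baseChange K) ((2 ^ κ * 2 ^ κ : ℕ) : ℤ)
            (resH1Hom (ContinuousMonoidHom.id _) fn hfn (s i)) =
          ((w a : (E.baseChange K).sha) :
            (E.baseChange K).galH1)) ∧
      (∀ (I : Finset ℕ) (β γ : ℤ) (α α' : ℕ → ℤ),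
        (β • kummerMapTorsion (E.baseChange K)
              ((2 ^ κ * 2 ^ κ : ℕ) : ℤ)
              (((E.baseChange K)).zsmul_geomPoints_surjective_of_charZero
                (Int.natCast_ne_zero.mpr (mul_ne_zero (pow_ne_zero κ two_ne_zero)
                  (pow_ne_zero κ two_ne_zero)))) x₀ +
          γ • resH1Hom (ContinuousMonoidHom.id _) fn hfn
            (kummerMapTorsion (E.baseChange K)
              ((2 ^ κ * 2 ^ κ : ℕ) : ℤ)
              (((E.baseChange K)).zsmul_geomPoints_surjective_of_charZero
                (Int.natCast_ne_zero.mpr (mul_ne_zero (pow_ne_zero κ two_ne_zero)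
                  (pow_ne_zero κ two_ne_zero)))) x₀)) +
            ∑ i ∈ I, (α i • s i + α' i • resH1Hom (ContinuousMonoidHom.id _) fn hfn (s i)) = 0 →
          β • kummerMapTorsion (E.baseChange K)
              ((2 ^ κ * 2 ^ κ : ℕ) : ℤ)
              (((E.baseChange K)).zsmul_geomPoints_surjective_of_charZero
                (Int.natCast_ne_zero.mpr (mul_ne_zero (pow_ne_zero κ two_ne_zero)
                  (pow_ne_zero κ two_ne_zero)))) x₀ +
            γ • resH1Hom (ContinuousMonoidHom.id _) fn hfn
              (kummerMapTorsion (E.baseChange K)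
                ((2 ^ κ * 2 ^ κ : ℕ) : ℤ)
                (((E.baseChange K)).zsmul_geomPoints_surjective_of_charZero
                  (Int.natCast_ne_zero.mpr (mul_ne_zero (pow_ne_zero κ two_ne_zero)
                    (pow_ne_zero κ two_ne_zero)))) x₀) = 0 ∧
          ∀ i ∈ I, α i • s i + α' i • resH1Hom (ContinuousMonoidHom.id _) fn hfn (s i) = 0) ∧
      (∀ d ∈ AddSubgroup.closure ((r '' (L : Set _)) ∪ w '' (r '' (L : Set _))),
        ∃ g ∈ AddSubgroup.closure ((((Finset.range m).image s : Finset _) : Set _) ∪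
          resH1Hom (ContinuousMonoidHom.id _) fn hfn '' (((Finset.range m).image s : Finset _) : Set _)),
          torsionH1ToH1 (E.baseChange K) ((2 ^ κ * 2 ^ κ : ℕ) : ℤ) g =
            ((d : (E.baseChange K).sha) :
              (E.baseChange K).galH1)) := by
  -- ### the level `n = 2^κ·2^κ`
  have hn : (((2 ^ κ * 2 ^ κ : ℕ) : ℤ)) ≠ 0 := Int.natCast_ne_zero.mpr (mul_ne_zero
    (pow_ne_zero κ two_ne_zero) (pow_ne_zero κ two_ne_zero))
  have h2κ : ((2 : ℤ) ^ (2 * κ)) = ((2 ^ κ * 2 ^ κ : ℕ) : ℤ) := by push_cast; ring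
  have hκn : ((2 : ℤ) ^ κ) * (2 : ℤ) ^ κ = ((2 ^ κ * 2 ^ κ : ℕ) : ℤ) := by push_cast; ring
  -- the inclusions `ιQ : Ш(E/ℚ)[2^∞] ↪ H¹(ℚ, E)` and `ι : Ш(E_K/K)[2^∞] ↪ H¹(K, E_K)`
  let ιQ : AddCommGroup.primaryComponent E.sha 2 →+ E.galH1 :=
    E.sha.subtype.comp (AddCommGroup.primaryComponent E.sha 2).subtype
  let ι : AddCommGroup.primaryComponent (E.baseChange K).sha 2 →+ (E.baseChange K).galH1 :=
    (E.baseChange K).sha.subtype.comp (AddCommGroup.primaryComponent (E.baseChange K).sha 2).subtype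
  have hιQ : ∀ c, ιQ c = ((c : E.sha) : E.galH1) := fun _ ↦ rfl
  have hιa : ∀ a, ι a = ((a : (E.baseChange K).sha) : (E.baseChange K).galH1) := fun _ ↦ rfl
  have hι : Function.Injective ι := fun a a' h ↦ Subtype.ext (Subtype.ext h)
  -- ### `hsurjQ`: `Sel_n(E/ℚ) ↠ Ш(E/ℚ)[n] ⊇ L` (AEC X.4.2(a) + `2^κ` kills `Ш(E/ℚ)[2^∞]`)
  have hkill : ∀ c : AddCommGroup.primaryComponent E.sha 2, ((2 : ℤ) ^ κ) • c = 0 := fun c ↦ by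
    apply Subtype.ext
    rw [AddSubgroupClass.coe_zsmul, ZeroMemClass.coe_zero, ← hkℚ c.1 c.2, ← natCast_zsmul]
    norm_cast
  have hsurjQ : ∀ c ∈ L, ∃ u ∈ selmerGroup E ((2 ^ κ * 2 ^ κ : ℕ) : ℤ), torsionH1ToH1 E ((2 ^ κ * 2 ^ κ : ℕ) : ℤ) u = ιQ c := by
    intro c _
    have hc : ιQ c ∈ E.sha ⊓ AddSubgroup.torsionBy E.galH1 ((2 ^ κ * 2 ^ κ : ℕ) : ℤ) := by
      refine ⟨(c : E.sha).2, AddSubgroup.torsionBy.nsmul_iff.mpr ?_⟩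
      rw [hιQ, ← AddSubgroupClass.coe_nsmul, mul_nsmul, hkℚ c.1 c.2, smul_zero, ZeroMemClass.coe_zero]
    rw [← WeierstrassCurve.map_torsionH1ToH1_selmerGroup_holds E hn, AddSubgroup.mem_map] at hc
    obtain ⟨u, hu, h⟩ := hc
    exact ⟨u, hu, h⟩
  -- ### `htors`: `H¹(ℚ, E[n])` is killed by `n = 2^{2κ}`
  have htors : ∀ u : galH1Torsion E ((2 ^ κ * 2 ^ κ : ℕ) : ℤ), ((2 : ℤ) ^ (2 * κ)) • u = 0 := fun u ↦ by
    rw [h2κ]; exact zsmul_galH1Torsion_eq_zero _ _ u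
  -- ### `res := resTorsion`, `hresSel`, `hcomp`
  have hresSel : ∀ u ∈ selmerGroup E ((2 ^ κ * 2 ^ κ : ℕ) : ℤ), resTorsion E K ((2 ^ κ * 2 ^ κ : ℕ) : ℤ) u ∈ selmerGroup (E.baseChange K) ((2 ^ κ * 2 ^ κ : ℕ) : ℤ) :=
    fun u hu ↦ resTorsion_mem_selmerGroup E K _ hu
  have hcomp : ∀ u ∈ selmerGroup E ((2 ^ κ * 2 ^ κ : ℕ) : ℤ), ∀ c : AddCommGroup.primaryComponent E.sha 2,
      torsionH1ToH1 E ((2 ^ κ * 2 ^ κ : ℕ) : ℤ) u = ιQ c →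
        torsionH1ToH1 (E.baseChange K) ((2 ^ κ * 2 ^ κ : ℕ) : ℤ) (resTorsion E K ((2 ^ κ * 2 ^ κ : ℕ) : ℤ) u) = ι (r c) := by
    intro u _ c h
    rw [torsionH1ToH1_resTorsion, h, hιQ, hιa, hr, coe_shaRestriction_apply]
  -- ### #K11: the admissible same-order lift of every Lagrangian vector
  have hlift := hlift_of_rational_lift L ιQ (selmerGroup E ((2 ^ κ * 2 ^ κ : ℕ) : ℤ)) (torsionH1ToH1 E ((2 ^ κ * 2 ^ κ : ℕ) : ℤ)) hsurjQ y hy hτy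
    (2 * κ) hfree htors hker r ι (selmerGroup (E.baseChange K) ((2 ^ κ * 2 ^ κ : ℕ) : ℤ)) Adm
    (torsionH1ToH1 (E.baseChange K) ((2 ^ κ * 2 ^ κ : ℕ) : ℤ)) (resTorsion E K ((2 ^ κ * 2 ^ κ : ℕ) : ℤ)) hresSel hresAdm hcomp
  -- ### the remaining #K10 binders
  have hprim : ∀ c : AddCommGroup.primaryComponent E.sha 2, ∃ k : ℕ, ((2 : ℤ) ^ k) • c = 0 :=
    fun c ↦ ⟨κ, hkill c⟩
  have hτw : ∀ c ∈ selmerGroup (E.baseChange K) ((2 ^ κ * 2 ^ κ : ℕ) : ℤ),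
      ∀ a : AddCommGroup.primaryComponent (E.baseChange K).sha 2,
      torsionH1ToH1 (E.baseChange K) ((2 ^ κ * 2 ^ κ : ℕ) : ℤ) c = ι a →
        torsionH1ToH1 (E.baseChange K) ((2 ^ κ * 2 ^ κ : ℕ) : ℤ) (resH1Hom (ContinuousMonoidHom.id _) fn hfn c) = ι (w a) := by
    intro c _ a h
    rw [hwS, h, hιa, hιa, hw]
  have hdesc : ∀ c ∈ L, ∀ d ∈ L, r c + w (r d) = 0 → c = 0 ∧ d = 0 := by
    intro c _ d _ h
    have h0 : (fun cd : AddCommGroup.primaryComponent E.sha 2 ×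
        AddCommGroup.primaryComponent E.sha 2 ↦ r cd.1 + w (r cd.2)) (c, d) =
        (fun cd : AddCommGroup.primaryComponent E.sha 2 ×
          AddCommGroup.primaryComponent E.sha 2 ↦ r cd.1 + w (r cd.2)) (0, 0) := by
      simp only [map_zero, add_zero]
      exact h
    have h1 := hbij.1 h0
    exact ⟨(Prod.mk.inj h1).1, (Prod.mk.inj h1).2⟩
  have he : ∀ c ∈ L, ((2 : ℤ) ^ κ) • c = 0 := fun c _ ↦ hkill c
  have hτx : torsionH1ToH1 (E.baseChange K) ((2 ^ κ * 2 ^ κ : ℕ) : ℤ) (kummerMapTorsion (E.baseChange K) ((2 ^ κ * 2 ^ κ : ℕ) : ℤ)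
      ((E.baseChange K).zsmul_geomPoints_surjective_of_charZero hn) x₀) = 0 :=
    torsionH1ToH1_kummerMapTorsion _ _ _ x₀
  have hτwx : torsionH1ToH1 (E.baseChange K) ((2 ^ κ * 2 ^ κ : ℕ) : ℤ) (resH1Hom (ContinuousMonoidHom.id _) fn hfn
      (kummerMapTorsion (E.baseChange K) ((2 ^ κ * 2 ^ κ : ℕ) : ℤ)
        ((E.baseChange K).zsmul_geomPoints_surjective_of_charZero hn) x₀)) = 0 := by
    rw [hwS, hτx, map_zero]
  -- ### #K10
  obtain ⟨m, s, N, h1, h2, h3, h4, h5, h6, h7, h8, h9⟩ :=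
    exists_lift_family L hprim r w ι hι (selmerGroup (E.baseChange K) ((2 ^ κ * 2 ^ κ : ℕ) : ℤ)) Adm h0
      (resH1Hom (ContinuousMonoidHom.id _) fn hfn) (torsionH1ToH1 (E.baseChange K) ((2 ^ κ * 2 ^ κ : ℕ) : ℤ)) hτw hdesc κ he
      (kummerMapTorsion (E.baseChange K) ((2 ^ κ * 2 ^ κ : ℕ) : ℤ)
        ((E.baseChange K).zsmul_geomPoints_surjective_of_charZero hn) x₀) hτx hτwx hlift
  refine ⟨m, s, N, h1, h2, h3, h4, h5, h6, fun i ↦ ?_, h8, fun d hd ↦ ?_⟩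
  · obtain ⟨a, ha, e1, e2⟩ := h7 i
    exact ⟨a, ha, e1, e2⟩
  · obtain ⟨g, hg, e⟩ := h9 d hd
    exact ⟨g, hg, e⟩

end LiftFamilyTree

end Summit.BirchSwinnertonDyer.BirchSwinnertonDyer.Theorems.SylvesterTwoCoupledTelescope

end
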